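import Literature.NumberTheory.LFunctions.NymanBeurlingRateResidue
import Literature.NumberTheory.LFunctions.ZetaShiftRatioBounds
import HarnessLib

/-!
# Balazard–de Roton 2010, Proposition 2: `J_ε ≪ ε` under RH

Topic `Literature/NumberTheory/LFunctions`; a brick of the proof of Balazard–de Roton 2010,
Théorème 1 (`Literature.NumberTheory.LFunctions.BalazardDeRoton2010_thm1`, `NymanBeurlingRate.lean`).
M. Balazard, A. de Roton, *Sur un critère de Báez-Duarte pour l'hypothèse de Riemann*, Int. J.
Number Theory 6 (2010) 883–903 = arXiv:0812.1689, §2 and §4: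

> **Proposition 2 (HR).** `J_ε ≪ ε`, where `J_ε = (1/2π)∫_{σ=1/2} |ζ(s)/ζ(s+ε) − 1|² dτ/|s|²`.

Printed proof (§4): `J_ε = K_ε − 2L_ε + 1`; `K_ε − 1 ≪ ε` by integrating Prop. 4 (ii) against
`dτ/|s|²` (note `(1/2π)∫dτ/|s|² = 1`); `L_ε = 1 − (γ+1)ε + O(ε²)` (Prop. 5). Here:

* `norm_lValue_sub_one_le` — the first-order form of Prop. 5's expansion:
  `|(γ−1)/ζ(1+ε) − ζ'(1+ε)/ζ(1+ε)² − 1| ≤ 14ε` for `0 < ε ≤ ε₀` (from `ζ₁(1) = 1`, `ζ₁` entire,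
  `1/ζ(w) = (w−1)/ζ₁(w)`);
* `exists_lintegral_jIntegrand_le` — **Proposition 2**: there are `C₁, ε₁ > 0` with
  `∫ |1 − ζ(½+iτ)/ζ(½+ε+iτ)|²/|½+iτ|² dτ ≤ C₁ ε` for `0 < ε ≤ ε₁` (as a lower Lebesgue
  integral; this is literally hypothesis `hJ` of
  `Literature.NumberTheory.LFunctions.BalazardDeRoton2010_thm1_of_props`, `jIntegrand` unfolded).

Inputs: Prop. 4 (ii) (`BalazardDeRoton.exists_norm_sq_zeta_half_le_one_add_mul`,
`ZetaShiftRatioBounds.lean`) and Prop. 5 (`BalazardDeRoton.integral_qFun_half`,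
`NymanBeurlingRateResidue.lean`).

## References

* [BalazardDeRoton2010] M. Balazard, A. de Roton, Int. J. Number Theory 6 (2010) 883–903,
  Prop. 2 (p. 3) and its proof (§4, p. 5); Prop. 5.
-/

noncomputable section

open Complex Filter Topology Set MeasureTheory Real

namespace Literature.NumberTheory.LFunctions

namespace BalazardDeRoton

open MertensBoundRH (zetaInv zetaInv_of_ne_one continuousOn_zetaInv)

/-! ## `1/ζ` near `s = 1` and the expansion of `L_ε` -/

/-- `zetaInv w = (w − 1)/ζ₁(w)` for every `w` (both sides vanish at `w = 1` and where `ζ₁ = 0`).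
[folklore] -/
lemma zetaInv_eq_sub_one_div (w : ℂ) : zetaInv w = (w - 1) / riemannZeta₁ w := by
  by_cases hw : w = 1
  · subst hw; simp [MertensBoundRH.zetaInv]
  · rw [zetaInv_of_ne_one hw, riemannZeta_eq_inv_sub_mul hw, mul_inv, inv_inv, div_eq_mul_inv]

/-- Near `s = 1`: there is `r > 0` such that `‖ζ₁(w) − 1‖ ≤ 1/2` and `‖ζ₁'(w)‖ ≤ 2` for
`‖w − 1‖ ≤ r` (`ζ₁(1) = 1`, `ζ₁'(1) = γ < 1`, continuity). [folklore] -/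
lemma exists_ball_riemannZeta₁ : ∃ r : ℝ, 0 < r ∧ ∀ w : ℂ, ‖w - 1‖ ≤ r →
    ‖riemannZeta₁ w - 1‖ ≤ 1 / 2 ∧ ‖deriv riemannZeta₁ w‖ ≤ 2 := by
  have hc1 : ContinuousAt riemannZeta₁ 1 := (differentiable_riemannZeta₁ 1).continuousAt
  have hc2 : ContinuousAt (deriv riemannZeta₁) 1 :=
    ((differentiable_riemannZeta₁.contDiff (n := 1)).continuous_deriv le_rfl).continuousAt
  obtain ⟨δ₁, hδ₁, h₁⟩ := Metric.continuousAt_iff.mp hc1 (1 / 2) one_half_pos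
  obtain ⟨δ₂, hδ₂, h₂⟩ := Metric.continuousAt_iff.mp hc2 1 one_pos
  refine ⟨min δ₁ δ₂ / 2, by positivity, fun w hw ↦ ⟨?_, ?_⟩⟩
  · have := h₁ (x := w) (by rw [dist_eq_norm]; linarith [min_le_left δ₁ δ₂])
    rw [dist_eq_norm, riemannZeta₁_one] at this
    exact this.le
  · have := h₂ (x := w) (by rw [dist_eq_norm]; linarith [min_le_right δ₁ δ₂])
    rw [dist_eq_norm, deriv_riemannZeta₁_one] at this
    have hγ : ‖(eulerMascheroniConstant : ℂ)‖ ≤ 1 := by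
      rw [Complex.norm_real, Real.norm_eq_abs, abs_le]
      constructor <;>
        linarith [Real.eulerMascheroniConstant_lt_two_thirds, Real.one_half_lt_eulerMascheroniConstant]
    calc ‖deriv riemannZeta₁ w‖ ≤ ‖deriv riemannZeta₁ w - eulerMascheroniConstant‖ +
          ‖(eulerMascheroniConstant : ℂ)‖ := norm_le_norm_sub_add _ _
      _ ≤ 2 := by linarith [this.le]

/-- **The expansion of `L_ε` to first order** (Balazard–de Roton, Prop. 5:
`L_ε = 1 − (γ+1)ε + O(ε²)`): there is `ε₀ > 0` with
`‖(γ−1)·zetaInv(1+ε) + zetaInv'(1+ε) − 1‖ ≤ 14ε` for `0 < ε ≤ ε₀`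
(`zetaInv(1+ε) = ε/ζ₁(1+ε)`, `zetaInv'(1+ε) = 1/ζ₁(1+ε) − εζ₁'(1+ε)/ζ₁(1+ε)²`, `ζ₁(1+ε) = 1+O(ε)`).
[cite: BalazardDeRoton2010, Prop. 5] -/
theorem norm_lValue_sub_one_le : ∃ ε₀ : ℝ, 0 < ε₀ ∧ ∀ ε : ℝ, 0 < ε → ε ≤ ε₀ →
    ‖(eulerMascheroniConstant - 1) * zetaInv (1 + ε) + deriv zetaInv (1 + ε) - 1‖ ≤ 14 * ε := by
  obtain ⟨r, hr, hball⟩ := exists_ball_riemannZeta₁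
  refine ⟨r, hr, fun ε hε hεr ↦ ?_⟩
  set w : ℂ := 1 + ε with hw
  have hw1 : ‖w - 1‖ = ε := by simp [hw, abs_of_pos hε]
  obtain ⟨hz1, hz'⟩ := hball w (by rw [hw1]; exact hεr)
  set z : ℂ := riemannZeta₁ w with hz
  set z' : ℂ := deriv riemannZeta₁ w with hz'def
  -- `‖z‖ ≥ 1/2`
  have hz0 : 1 / 2 ≤ ‖z‖ := by
    have := norm_sub_norm_le (1 : ℂ) z
    rw [norm_one, norm_sub_rev] at this; linarith
  have hzne : z ≠ 0 := fun h ↦ by rw [h, norm_zero] at hz0; linarith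
  -- `‖z − 1‖ ≤ 2ε` (mean value inequality on `[1, 1+ε]`)
  have hzsub : ‖z - 1‖ ≤ 2 * ε := by
    have hseg : ∀ u ∈ segment ℝ (1 : ℂ) w, ‖u - 1‖ ≤ r := by
      intro u hu
      rw [segment_eq_image'] at hu
      obtain ⟨θ, hθ, rfl⟩ := hu
      simp only [add_sub_cancel_left, hw]
      rw [norm_smul, Real.norm_eq_abs, abs_of_nonneg hθ.1, Complex.norm_real, Real.norm_eq_abs,
        abs_of_pos hε]
      nlinarith [hθ.2]
    have h := (convex_segment (1 : ℂ) w).norm_image_sub_le_of_norm_deriv_le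
      (f := riemannZeta₁) (fun u _ ↦ differentiable_riemannZeta₁ u)
      (fun u hu ↦ (hball u (hseg u hu)).2) (left_mem_segment ℝ 1 w) (right_mem_segment ℝ 1 w)
    rw [riemannZeta₁_one, hw1] at h
    exact h
  -- the two values of `zetaInv`
  have hval : zetaInv (1 + ε) = ε / z := by
    rw [zetaInv_eq_sub_one_div, hz, hw]; congr 1; ring
  have hder : deriv zetaInv (1 + ε) = 1 / z - ε * z' / z ^ 2 := by
    have hfun : zetaInv = fun u ↦ (u - 1) / riemannZeta₁ u := funext zetaInv_eq_sub_one_div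
    rw [hfun]
    have h1 : HasDerivAt (fun u : ℂ ↦ u - 1) 1 w := (hasDerivAt_id w).sub_const 1
    have h2 : HasDerivAt riemannZeta₁ z' w := (differentiable_riemannZeta₁ w).hasDerivAt
    have h : HasDerivAt (fun u : ℂ ↦ (u - 1) / riemannZeta₁ u)
        ((1 * z - (w - 1) * z') / z ^ 2) w := h1.div h2 hzne
    rw [← hw, h.deriv]
    have hw1' : w - 1 = ε := by simp [hw]
    rw [hw1']
    field_simp
  rw [hval, hder]
  -- estimate
  have e : (eulerMascheroniConstant - 1) * (ε / z) + (1 / z - ε * z' / z ^ 2) - 1 =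
      (eulerMascheroniConstant - 1) * ε / z + (1 - z) / z - ε * z' / z ^ 2 := by
    field_simp; ring
  rw [e]
  have hγ : ‖(eulerMascheroniConstant : ℂ) - 1‖ ≤ 1 := by
    rw [show (eulerMascheroniConstant : ℂ) - 1 = ((eulerMascheroniConstant - 1 : ℝ) : ℂ) by
      push_cast; ring, Complex.norm_real, Real.norm_eq_abs, abs_le]
    constructor <;>
      linarith [Real.eulerMascheroniConstant_lt_two_thirds, Real.one_half_lt_eulerMascheroniConstant]
  have hzinv : ‖z‖⁻¹ ≤ 2 := by rw [inv_le_comm₀ (by linarith) two_pos]; linarith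
  have hε' : ‖(ε : ℂ)‖ = ε := by rw [Complex.norm_real, Real.norm_eq_abs, abs_of_pos hε]
  have t1 : ‖(eulerMascheroniConstant - 1) * ε / z‖ ≤ 2 * ε := by
    rw [norm_div, norm_mul, hε', div_eq_mul_inv]
    calc ‖(eulerMascheroniConstant : ℂ) - 1‖ * ε * ‖z‖⁻¹ ≤ 1 * ε * 2 := by gcongr
      _ = 2 * ε := by ring
  have t2 : ‖(1 - z) / z‖ ≤ 4 * ε := by
    rw [norm_div, norm_sub_rev, div_eq_mul_inv]
    calc ‖z - 1‖ * ‖z‖⁻¹ ≤ (2 * ε) * 2 := by gcongr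
      _ = 4 * ε := by ring
  have t3 : ‖ε * z' / z ^ 2‖ ≤ 8 * ε := by
    rw [norm_div, norm_mul, hε', norm_pow, div_eq_mul_inv, ← inv_pow]
    calc ε * ‖z'‖ * ‖z‖⁻¹ ^ 2 ≤ ε * 2 * 2 ^ 2 := by gcongr
      _ = 8 * ε := by ring
  calc ‖(eulerMascheroniConstant - 1) * ε / z + (1 - z) / z - ε * z' / z ^ 2‖
      ≤ ‖(eulerMascheroniConstant - 1) * ε / z‖ + ‖(1 - z) / z‖ + ‖ε * z' / z ^ 2‖ :=
        norm_add_sub_le' _ _ _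
    _ ≤ 2 * ε + 4 * ε + 8 * ε := by linarith
    _ = 14 * ε := by ring
  where
  /-- `‖a + b − c‖ ≤ ‖a‖ + ‖b‖ + ‖c‖`. [folklore] -/
  norm_add_sub_le' (a b c : ℂ) : ‖a + b - c‖ ≤ ‖a‖ + ‖b‖ + ‖c‖ :=
    (norm_sub_le _ _).trans (add_le_add (norm_add_le _ _) le_rfl)

/-! ## The integrand of `J_ε` decomposed: `|1 − w|² = 1 − 2 Re w + |w|²` -/

/-- Continuity of `τ ↦ ζ(½ + iτ)`. [folklore] -/
lemma continuous_zeta_half : Continuous fun τ : ℝ ↦ riemannZeta (1 / 2 + τ * I) := by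
  have hc : Continuous fun τ : ℝ ↦ (1 / 2 + τ * I : ℂ) := by fun_prop
  refine continuous_iff_continuousAt.2 fun τ ↦ ?_
  have hs : (1 / 2 + τ * I : ℂ) ≠ 1 := fun h ↦ by
    have := congrArg Complex.re h; simp at this
  exact ContinuousAt.comp (f := fun τ : ℝ ↦ (1 / 2 + τ * I : ℂ))
    (differentiableAt_riemannZeta hs).continuousAt hc.continuousAt

/-- **`J`-integrand decomposition** (B.–de R. §4: `J_ε = K_ε − 2L_ε + 1` at the level of
integrands): under RH, for `0 < ε ≤ 1/4` and `s = ½ + iτ`,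
`|1 − ζ(s)/ζ(s+ε)|²/|s|² = 1/|s|² − 2 Re Q(s) + |Q(s)|²|s|²` with `Q = qFun ε`
(`Q(s) = ζ(s)ζ(s+ε)⁻¹/|s|²` on the line). [cite: BalazardDeRoton2010, §4 (t60)] -/
lemma jIntegrand_eq {ε : ℝ} (hε : 0 < ε) (hε1 : ε ≤ 1 / 4) (τ : ℝ) :
    ‖1 - riemannZeta (1 / 2 + τ * I) / riemannZeta (1 / 2 + ε + τ * I)‖ ^ 2 /
        ‖(1 / 2 + τ * I : ℂ)‖ ^ 2 =
      (‖(1 / 2 + τ * I : ℂ)‖ ^ 2)⁻¹ - 2 * (qFun ε (((1 / 2 : ℝ) : ℂ) + τ * I)).re +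
        ‖qFun ε (((1 / 2 : ℝ) : ℂ) + τ * I)‖ ^ 2 * ‖(1 / 2 + τ * I : ℂ)‖ ^ 2 := by
  set s : ℂ := 1 / 2 + τ * I with hs
  have e0 : (((1 / 2 : ℝ) : ℂ) + τ * I) = s := by rw [hs]; push_cast; ring
  have hsε : s + ε = 1 / 2 + ε + τ * I := by rw [hs]; ring
  have hs1 : s + ε ≠ 1 := fun h ↦ by
    have := congrArg Complex.re h; simp [hs] at this; linarith
  set w : ℂ := riemannZeta s * zetaInv (s + ε) with hw
  have hdiv : riemannZeta s / riemannZeta (1 / 2 + ε + τ * I) = w := by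
    rw [hw, zetaInv_of_ne_one hs1, hsε, div_eq_mul_inv]
  have hn0 : 0 < ‖s‖ ^ 2 := by
    have : 1 / 2 ≤ ‖s‖ := by
      have h := abs_re_le_norm s; simp [hs] at h; norm_num at h ⊢; linarith [h]
    positivity
  have hq : qFun ε s = w / ((‖s‖ ^ 2 : ℝ) : ℂ) := by rw [hs, qFun_half, ← hs]
  rw [e0, hdiv, hq, Complex.div_ofReal_re, norm_div, Complex.norm_real, Real.norm_of_nonneg hn0.le]
  have e1 : ‖1 - w‖ ^ 2 = 1 - 2 * w.re + ‖w‖ ^ 2 := by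
    rw [Complex.sq_norm, Complex.sq_norm, Complex.normSq_apply, Complex.normSq_apply]
    simp; ring
  rw [e1]
  field_simp

/-! ## Two integrals against `dτ/|s|²` -/

/-- `∫ dτ/|½+iτ|² = 2π` (and integrability). [folklore] -/
lemma integral_inv_norm_sq_half :
    Integrable (fun τ : ℝ ↦ (‖(1 / 2 + τ * I : ℂ)‖ ^ 2)⁻¹) ∧
      ∫ τ : ℝ, (‖(1 / 2 + τ * I : ℂ)‖ ^ 2)⁻¹ = 2 * π := by
  have heq : (fun τ : ℝ ↦ (‖(1 / 2 + τ * I : ℂ)‖ ^ 2)⁻¹) = fun τ ↦ ((1 / 2 : ℝ) ^ 2 + τ ^ 2)⁻¹ := by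
    funext τ
    rw [Complex.sq_norm, Complex.normSq_apply]; simp; ring
  rw [heq]
  obtain ⟨hint, hval⟩ := integral_inv_sq_add_sq (a := 1 / 2) one_half_pos
  refine ⟨hint, ?_⟩
  rw [hval]; ring

/-- `(1+|τ|)²/8 ≤ |½+iτ|²`. [folklore] -/
lemma one_add_abs_sq_le (τ : ℝ) : (1 + |τ|) ^ 2 / 8 ≤ ‖(1 / 2 + τ * I : ℂ)‖ ^ 2 := by
  rw [Complex.sq_norm, Complex.normSq_apply]
  simp
  have := sq_abs τ
  nlinarith [abs_nonneg τ]

/-- The weight `(1+|τ|)^{1/2}/|½+iτ|²` of Prop. 4 (ii) is integrable (`≪ (1+|τ|)^{-3/2}`).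
[folklore] -/
lemma integrable_rpow_half_div_norm_sq :
    Integrable fun τ : ℝ ↦ (1 + |τ|) ^ (1 / 2 : ℝ) / ‖(1 / 2 + τ * I : ℂ)‖ ^ 2 := by
  have hint : Integrable fun τ : ℝ ↦ 8 * (1 + ‖τ‖) ^ (-(3 / 2 : ℝ)) :=
    (integrable_one_add_norm (by simp; norm_num)).const_mul _
  refine hint.mono' ?_ (ae_of_all _ fun τ ↦ ?_)
  · refine (Continuous.div ((by fun_prop : Continuous fun τ : ℝ ↦ 1 + |τ|).rpow_const
      fun _ ↦ Or.inr (by norm_num)) ((continuous_norm.comp (by fun_prop)).pow 2)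
      fun τ ↦ ?_).aestronglyMeasurable
    have := one_add_abs_sq_le τ
    have h0 : 0 < (1 + |τ|) ^ 2 / 8 := by positivity
    exact (h0.trans_le this).ne'
  have hT : 0 < 1 + |τ| := by positivity
  have hden := one_add_abs_sq_le τ
  have h0 : 0 < (1 + |τ|) ^ 2 / 8 := by positivity
  rw [Real.norm_of_nonneg (by positivity), Real.norm_eq_abs, div_le_iff₀ (h0.trans_le hden)]
  calc (1 + |τ|) ^ (1 / 2 : ℝ) = 8 * (1 + |τ|) ^ (-(3 / 2 : ℝ)) * ((1 + |τ|) ^ 2 / 8) := by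
        rw [show ((1 + |τ|) ^ 2 : ℝ) = (1 + |τ|) ^ (2 : ℝ) by norm_cast]
        rw [mul_assoc, mul_div_assoc', ← Real.rpow_add hT]
        norm_num
        field_simp
    _ ≤ 8 * (1 + |τ|) ^ (-(3 / 2 : ℝ)) * ‖(1 / 2 + τ * I : ℂ)‖ ^ 2 := by gcongr

/-! ## Proposition 2 -/

/-- Pointwise: `|Q(s)|²|s|² = |ζ(s)ζ(s+ε)⁻¹|²/|s|² ≤ (1 + C₂ε(1+|τ|)^{1/2})/|s|²` on `σ = 1/2`,
from Prop. 4 (ii). [cite: BalazardDeRoton2010, Prop. 4 (ii) and §4 ("K_ε − 1 ≪ ε")] -/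
lemma norm_sq_qFun_mul_le {ε C₂ : ℝ} (hε : 0 < ε) (hε1 : ε ≤ 1 / 4) (hC₂ : 0 ≤ C₂)
    (h4 : ∀ τ : ℝ, ‖riemannZeta (1 / 2 + τ * I)‖ ^ 2 ≤
      (1 + C₂ * ε * (1 + |τ|) ^ (1 / 2 : ℝ)) * ‖riemannZeta (1 / 2 + ε + τ * I)‖ ^ 2) (τ : ℝ) :
    ‖qFun ε (((1 / 2 : ℝ) : ℂ) + τ * I)‖ ^ 2 * ‖(1 / 2 + τ * I : ℂ)‖ ^ 2 ≤
      (‖(1 / 2 + τ * I : ℂ)‖ ^ 2)⁻¹ +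
        C₂ * ε * ((1 + |τ|) ^ (1 / 2 : ℝ) / ‖(1 / 2 + τ * I : ℂ)‖ ^ 2) := by
  set s : ℂ := 1 / 2 + τ * I with hs
  have e0 : (((1 / 2 : ℝ) : ℂ) + τ * I) = s := by rw [hs]; push_cast; ring
  have hsε : s + ε = 1 / 2 + ε + τ * I := by rw [hs]; ring
  have hs1 : s + ε ≠ 1 := fun h ↦ by
    have := congrArg Complex.re h; simp [hs] at this; linarith
  have hn0 : 0 < ‖s‖ ^ 2 := lt_of_lt_of_le (by positivity) (one_add_abs_sq_le τ)
  -- `‖ζ(s) zetaInv(s+ε)‖² ≤ 1 + C₂ε(1+|τ|)^{1/2}`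
  have hw : ‖riemannZeta s * zetaInv (s + ε)‖ ^ 2 ≤ 1 + C₂ * ε * (1 + |τ|) ^ (1 / 2 : ℝ) := by
    rw [zetaInv_of_ne_one hs1, hsε, norm_mul, mul_pow, norm_inv, inv_pow]
    by_cases hz : riemannZeta (1 / 2 + ε + τ * I) = 0
    · rw [hz, norm_zero]
      simp only [ne_eq, OfNat.ofNat_ne_zero, not_false_eq_true, zero_pow, inv_zero, mul_zero]
      positivity
    · have h0 : 0 < ‖riemannZeta (1 / 2 + ε + τ * I)‖ ^ 2 := by positivity
      rw [← div_eq_mul_inv, div_le_iff₀ h0]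
      exact h4 τ
  rw [e0, qFun_half, ← hs, norm_div, Complex.norm_real, Real.norm_of_nonneg hn0.le, div_pow]
  have lhs : ‖riemannZeta s * zetaInv (s + ε)‖ ^ 2 / (‖s‖ ^ 2) ^ 2 * ‖s‖ ^ 2 =
      ‖riemannZeta s * zetaInv (s + ε)‖ ^ 2 / ‖s‖ ^ 2 := by field_simp
  have rhs : (‖s‖ ^ 2)⁻¹ + C₂ * ε * ((1 + |τ|) ^ (1 / 2 : ℝ) / ‖s‖ ^ 2) =
      (1 + C₂ * ε * (1 + |τ|) ^ (1 / 2 : ℝ)) / ‖s‖ ^ 2 := by field_simp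
  rw [lhs, rhs]
  exact div_le_div_of_nonneg_right hw hn0.le

/-- **Balazard–de Roton 2010, Proposition 2 (HR): `J_ε ≪ ε`.** Under RH there are `C₁` and
`ε₁ > 0` such that for `0 < ε ≤ ε₁`,
`∫_ℝ |1 − ζ(½+iτ)/ζ(½+ε+iτ)|² dτ/|½+iτ|² ≤ C₁ ε`
(i.e. `2πJ_ε ≤ C₁ε`; stated as a lower Lebesgue integral — hypothesis `hJ` of
`BalazardDeRoton2010_thm1_of_props` with `jIntegrand` unfolded). Proof: integrate the
decomposition `jIntegrand_eq`: `∫dτ/|s|² = 2π`, `∫ Re Q = Re 2πL_ε ≥ 2π(1 − 14ε)` (Prop. 5),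
`∫|Q|²|s|² ≤ 2π + C₂ε∫(1+|τ|)^{1/2}dτ/|s|²` (Prop. 4 (ii)). [cite: BalazardDeRoton2010, Prop. 2] -/
theorem exists_lintegral_jIntegrand_le (hRH : RiemannHypothesis) :
    ∃ C₁ ε₁ : ℝ, 0 < ε₁ ∧ ∀ ε : ℝ, 0 < ε → ε ≤ ε₁ →
      ∫⁻ τ : ℝ, ENNReal.ofReal
        (‖1 - riemannZeta (1 / 2 + τ * I) / riemannZeta (1 / 2 + ε + τ * I)‖ ^ 2 /
          ‖(1 / 2 + τ * I : ℂ)‖ ^ 2) ≤ ENNReal.ofReal (C₁ * ε) := by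
  obtain ⟨ε₀, hε₀, hL⟩ := norm_lValue_sub_one_le
  obtain ⟨C₂, hC₂, h4⟩ := exists_norm_sq_zeta_half_le_one_add_mul hRH
  obtain ⟨hI1, hI1v⟩ := integral_inv_norm_sq_half
  have hIw := integrable_rpow_half_div_norm_sq
  set M : ℝ := ∫ τ : ℝ, (1 + |τ|) ^ (1 / 2 : ℝ) / ‖(1 / 2 + τ * I : ℂ)‖ ^ 2 with hM
  have hM0 : 0 ≤ M := integral_nonneg fun τ ↦ by positivity
  refine ⟨56 * π + C₂ * M, min ε₀ (1 / 4), by positivity, fun ε hε hε1 ↦ ?_⟩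
  have hεε₀ : ε ≤ ε₀ := hε1.trans (min_le_left _ _)
  have hε4 : ε ≤ 1 / 4 := hε1.trans (min_le_right _ _)
  -- the pieces of the decomposition
  set q : ℝ → ℂ := fun τ ↦ qFun ε (((1 / 2 : ℝ) : ℂ) + τ * I) with hqdef
  have hq_int : Integrable q := integrable_qFun_half hRH hε hε4
  have hq_cont : Continuous q :=
    continuous_qFun_line hRH hε (by linarith) (σ := 1 / 2) le_rfl (by norm_num)
  set g₃ : ℝ → ℝ := fun τ ↦ ‖q τ‖ ^ 2 * ‖(1 / 2 + τ * I : ℂ)‖ ^ 2 with hg₃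
  set h₃ : ℝ → ℝ := fun τ ↦ (‖(1 / 2 + τ * I : ℂ)‖ ^ 2)⁻¹ +
    C₂ * ε * ((1 + |τ|) ^ (1 / 2 : ℝ) / ‖(1 / 2 + τ * I : ℂ)‖ ^ 2) with hh₃
  have hh₃_int : Integrable h₃ := hI1.add (hIw.const_mul _)
  have hg₃_le : ∀ τ, g₃ τ ≤ h₃ τ := fun τ ↦
    norm_sq_qFun_mul_le hε hε4 hC₂.le (fun τ ↦ h4 τ ε hε.le hε4) τ
  have hg₃_nn : ∀ τ, 0 ≤ g₃ τ := fun τ ↦ by positivity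
  have hg₃_int : Integrable g₃ := by
    refine hh₃_int.mono' ?_ (ae_of_all _ fun τ ↦ ?_)
    · exact ((hq_cont.norm.pow 2).mul ((continuous_norm.comp (by fun_prop)).pow 2)
        ).aestronglyMeasurable
    · rw [Real.norm_of_nonneg (hg₃_nn τ)]; exact hg₃_le τ
  -- the integrand and its integral
  set f : ℝ → ℝ := fun τ ↦ ‖1 - riemannZeta (1 / 2 + τ * I) / riemannZeta (1 / 2 + ε + τ * I)‖ ^ 2 /
    ‖(1 / 2 + τ * I : ℂ)‖ ^ 2 with hf
  have hf_eq : f = fun τ : ℝ ↦ ((‖(1 / 2 + τ * I : ℂ)‖ ^ 2)⁻¹ - 2 * (q τ).re) + g₃ τ :=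
    funext fun τ ↦ jIntegrand_eq hε hε4 τ
  have hre_int : Integrable fun τ ↦ (q τ).re := hq_int.re
  have hf_int : Integrable f := by
    rw [hf_eq]; exact (hI1.sub (hre_int.const_mul 2)).add hg₃_int
  have hf_nn : ∀ τ, 0 ≤ f τ := fun τ ↦ by positivity
  have hf_val : ∫ τ, f τ = 2 * π - 2 * (∫ τ, q τ).re + ∫ τ, g₃ τ := by
    have hA : Integrable fun τ : ℝ ↦ (‖(1 / 2 + τ * I : ℂ)‖ ^ 2)⁻¹ - 2 * (q τ).re :=
      hI1.sub (hre_int.const_mul 2)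
    have e0 : ∫ τ, f τ = ∫ τ : ℝ, ((‖(1 / 2 + τ * I : ℂ)‖ ^ 2)⁻¹ - 2 * (q τ).re + g₃ τ) := by
      rw [hf_eq]
    have e1 : ∫ τ : ℝ, ((‖(1 / 2 + τ * I : ℂ)‖ ^ 2)⁻¹ - 2 * (q τ).re + g₃ τ) =
        (∫ τ : ℝ, ((‖(1 / 2 + τ * I : ℂ)‖ ^ 2)⁻¹ - 2 * (q τ).re)) + ∫ τ, g₃ τ :=
      integral_add hA hg₃_int
    have e2 : ∫ τ : ℝ, ((‖(1 / 2 + τ * I : ℂ)‖ ^ 2)⁻¹ - 2 * (q τ).re) =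
        (∫ τ : ℝ, (‖(1 / 2 + τ * I : ℂ)‖ ^ 2)⁻¹) - ∫ τ : ℝ, 2 * (q τ).re :=
      integral_sub hI1 (hre_int.const_mul 2)
    have e3 : ∫ τ : ℝ, 2 * (q τ).re = 2 * (∫ τ, q τ).re := by
      rw [integral_const_mul]
      have := integral_re hq_int
      simp only [RCLike.re_to_complex] at this
      rw [this]
    rw [e0, e1, e2, e3, hI1v]
  -- Prop. 5 and its expansion
  have hq_val : ∫ τ, q τ = 2 * π * ((eulerMascheroniConstant - 1) * zetaInv (1 + ε) +
      deriv zetaInv (1 + ε)) := integral_qFun_half hRH hε hε4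
  set L : ℂ := (eulerMascheroniConstant - 1) * zetaInv (1 + ε) + deriv zetaInv (1 + ε) with hLdef
  have hLre : 1 - 14 * ε ≤ L.re := by
    have h1 := hL ε hε hεε₀
    have h2 : |(L - 1).re| ≤ ‖L - 1‖ := abs_re_le_norm _
    rw [sub_re, one_re] at h2
    have := (abs_le.mp (h2.trans h1)).1
    linarith
  have hqre : (∫ τ, q τ).re = 2 * π * L.re := by
    rw [hq_val]; simp [Complex.mul_re]
  -- Prop. 4 (ii) integrated
  have hg₃_val : ∫ τ, g₃ τ ≤ 2 * π + C₂ * ε * M := by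
    calc ∫ τ, g₃ τ ≤ ∫ τ, h₃ τ := integral_mono hg₃_int hh₃_int hg₃_le
      _ = 2 * π + C₂ * ε * M := by
          rw [hh₃, integral_add hI1 (hIw.const_mul _), integral_const_mul, hI1v]
  -- conclusion
  rw [← ofReal_integral_eq_lintegral_ofReal hf_int (ae_of_all _ hf_nn)]
  refine ENNReal.ofReal_le_ofReal ?_
  rw [hf_val, hqre]
  have hπ := Real.pi_pos
  nlinarith [mul_le_mul_of_nonneg_left hLre (by positivity : (0 : ℝ) ≤ 4 * π), hg₃_val,
    mul_nonneg hC₂.le hM0]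

end BalazardDeRoton

end Literature.NumberTheory.LFunctions

end
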